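import Literature.Probability.Percolation.MarkedLoopHolomorphicDefect
import HarnessLib

/-!
# Certified censuses of cores at a face («CORE-CENSUS»): the finite kit behind the picture counts `c_P(v)`

Topic `Literature/Probability/Percolation`; generic-`k` layer of the three-disorder lineage (Khristoforov–Smirnov 2021), a sequel of
`MarkedLoopHolomorphicDefect.lean` (TRIPOD-DEFECT: at a face `v` with three `H_G`-sides of a `k`-marked domain `D`,
`Σ_i τ^i ObsW D wt v i = Σ_P c_P(v) · tripodDefect wt P` with `c_P(v) = pictureCount D v P ∈ ℕ` the number of re-linking cores at `v` with
picture `P`). To USE that formula on a concrete marked domain one must EVALUATE the counts `c_P(v)`, i.e. enumerate ALL cores at `v` — the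
edge sets `ζ ⊆ E⁻(v)` whose odd faces are the corners XOR the three neighbours of `v` — and read the picture of each. This file is the
domain-independent kit that turns such a census into finitely many `decide`s:

* `§ Universe` — `hBonds_subset_of_triDir` / `eminus_subset_of_triDir`: the bonds of `H_G` lie in any explicit finset containing the six
  bonds at every site of `G`; `subset_eminus_of_darts`: conversely an explicit set of darts with an endpoint in `G`, avoiding the sides of
  `v`, lies in `E⁻(v)`; `isCoreb_of_parity`: the core property from a tabulated parity profile.
* `§ Peeling` — ★ `core_eq_of_agree` (UNIQUENESS OF A CORE GIVEN ITS FREE PART): if a PEELING SCHEDULE — a list of (face, side) pairs in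
  which, at each step, the two other sides of the face are already determined (free, scheduled earlier, or outside `E⁻(v)`) and which
  exhausts `E⁻(v)` — passes the finite check `schedOK`, then two cores at `v` with the same odd-neighbour set that agree on the free bonds
  are EQUAL (the parity at the scheduled face pins the scheduled side: leaf-peeling of the forest `E⁻(v) ∖ Free`, i.e. Gaussian
  elimination over `𝔽₂` certified step by step); ★ `core_eq_table`: hence every core is the tabulated core with the same free part, once
  the table realises every subset of `Free`.
* `§ Labelling` — ★ `hasPicture_iff_of_labelling`: the PICTURE of a tabulated core read WITHOUT PATHS: a labelling of the faces that is
  constant across the bonds of the core (a finite check) separates the three neighbours, and then the partner corners and the link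
  relation are forced by the tree's structure theorems (`hbK_core_partners`, `tripodPicture_of_core`: partners exist, the link relation is
  a perfect matching of the other corners) — only label (in)equalities are checked, never connectivity.
* `§ Counting` — ★ `pictureCount_eq_card_filter`: with a complete injective table `core : ι → _` of the cores with all neighbours odd and
  their pictures `pic : ι → Option (PicIdx k)`, `pictureCount D v P = #{i | pic i = some P}` — a `decide`.

The three sections are independent of the number of marks and of the domain; the lane's use is the census of the 2 × 4 rhombus at seven
marks (necessity of the tripod law at `k = 7`), where each face carries `2^6 = 64` cores.

## References
* M. Khristoforov, S. Smirnov, *Percolation and O(1) loop model*, arXiv:2111.15612 (2021), §1.2 (arXiv v1 pp. 2–3: loop configurations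
  `W_Ω(U) = {ξ : ∂ξ = U}`, «exactly `2^{#Faces(Ω)}` loop configurations», the link pattern `IP(ξ)`), §2 Lemma 4 with its proof and Fig. 3
  (p. 4: configurations grouped in triples at a vertex — the cores).
* B. Bollobás, O. Riordan, *Percolation*, Cambridge University Press (2006), Ch. 7 §7.2.2 (pp. 191–195: marked discrete domains), Lemma 12
  (pp. 206–207: faces and opposite faces).

## Mathlib / tree
Tree: `KhSThreeDisorderObservable.lean` (`IsCoreb`, `Eminus`, `coreSetb`, `ParityIs`, `AllSides`, `hbK_core_partners`), `MarkedLoopHolomorphicDefect.lean`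
(`PicIdx`, `HasPicture`, `IsRelinking`, `pictureCount`, `hasPicture_iff_eq`), `MarkedLoopHolomorphy.lean` (`tripodPicture_of_core`, `eq_partner_of_linked`,
`linkRel`, `mem_linkRel`, `core_subset_hBonds`), `MarkedLoopSpace.lean` (`hBonds`, `exists_rep_of_mem_hBonds`, `mem_hBonds`, `mem_touching_of_side_mem`, `yc`,
`corners`), `TriDiscShelling.lean` (`triDir`, `triGraph_adj_iff_triDir`). Mathlib: `Relation.ReflTransGen` induction, `Finset.card_bij`, `decide`.
-/

open Finset

namespace Literature.Probability.Percolation.MarkedLoops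

open Literature.Probability.Percolation Literature.Probability.LatticeModels
open Literature.Probability.Percolation.FivePoint (xiDeg XiLinked side)
open TriMarkedDomain

variable {nm : ℕ} {D : TriMarkedDomain nm}

/-! ### The bond universe of a concrete domain -/
section Universe

variable (D) in
/-- the bonds of `H_G` lie in any finset containing the six bonds at every site of `G`.
[cite: KhristoforovSmirnov2021, §1.2 (arXiv v1 pp. 2–3: the edges of `Ω`)] -/
theorem hBonds_subset_of_triDir {HB : Finset (Sym2 (Site 2))} (h : ∀ u ∈ D.verts, ∀ j : Fin 6, s(u, u + triDir j) ∈ HB) :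
    hBonds D ⊆ HB := by
  intro b hb
  obtain ⟨u, w, rfl, hu, hadj⟩ := exists_rep_of_mem_hBonds D hb
  obtain ⟨j, rfl⟩ := (triGraph_adj_iff_triDir u w).1 hadj
  exact h u hu j

/-- hence so does `E⁻(v)`, and every core at `v`. [cite: KhristoforovSmirnov2021, §2 Lemma 4, proof and Fig. 3 (p. 4)] -/
theorem core_subset_of_triDir {v : HexVertex} {S : Finset (Fin 3)} {ζ : Finset (Sym2 (Site 2))} (hq : IsCoreb D v S ζ)
    {HB : Finset (Sym2 (Site 2))} (h : ∀ u ∈ D.verts, ∀ j : Fin 6, s(u, u + triDir j) ∈ HB) : ζ ⊆ HB := by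
  intro b hb
  have hbE := hq.1 hb
  unfold Eminus at hbE
  exact hBonds_subset_of_triDir D h (Finset.mem_filter.1 hbE).1

variable (D) in
/-- `E⁻(v)` lies in the explicit universe: the bonds at the sites of `G` other than the three sides of `v`.
[cite: KhristoforovSmirnov2021, §2 Lemma 4, proof and Fig. 3 (p. 4)] -/
theorem eminus_subset_of_triDir (v : HexVertex) {HB : Finset (Sym2 (Site 2))} (h : ∀ u ∈ D.verts, ∀ j : Fin 6, s(u, u + triDir j) ∈ HB) :
    Eminus D v ⊆ HB.filter fun b => ∀ j : Fin 3, b ≠ side v j := by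
  intro b hb
  unfold Eminus at hb
  obtain ⟨hbh, hbs⟩ := Finset.mem_filter.1 hb
  exact Finset.mem_filter.2 ⟨hBonds_subset_of_triDir D h hbh, hbs⟩

/-- a core avoids the three sides of its face. [cite: KhristoforovSmirnov2021, §2 Lemma 4, proof and Fig. 3 (p. 4)] -/
theorem side_not_mem_of_isCoreb {v : HexVertex} {S : Finset (Fin 3)} {ζ : Finset (Sym2 (Site 2))} (hq : IsCoreb D v S ζ) (j : Fin 3) :
    side v j ∉ ζ := by
  intro hb
  have hbE := hq.1 hb
  unfold Eminus at hbE
  exact (Finset.mem_filter.1 hbE).2 j rfl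

variable (D) in
/-- an explicit set of darts, each with an endpoint in `G` and avoiding the sides of `v`, spans bonds of `E⁻(v)`.
[cite: KhristoforovSmirnov2021, §2 Lemma 4, proof and Fig. 3 (p. 4)] -/
theorem subset_eminus_of_darts {v : HexVertex} {E : Finset (Site 2 × Site 2)}
    (h : ∀ d ∈ E, triGraph.Adj d.1 d.2 ∧ (d.1 ∈ D.verts ∨ d.2 ∈ D.verts) ∧ ∀ j : Fin 3, s(d.1, d.2) ≠ side v j)
    {ζ : Finset (Sym2 (Site 2))} (hζ : ∀ b ∈ ζ, ∃ d ∈ E, b = s(d.1, d.2)) : ζ ⊆ Eminus D v := by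
  intro b hb
  obtain ⟨d, hd, rfl⟩ := hζ b hb
  obtain ⟨hadj, hG, hside⟩ := h d hd
  unfold Eminus
  exact Finset.mem_filter.2 ⟨mem_hBonds D hadj hG, hside⟩

/-- the core property from a tabulated parity profile (`% 2` form, as `decide` produces it) and a table of the corner faces.
[cite: KhristoforovSmirnov2021, §2 Lemma 4, proof and Fig. 3 (p. 4); §1.2 (pp. 2–3: `∂ξ = U`)] -/
theorem isCoreb_of_parity {v : HexVertex} {S : Finset (Fin 3)} (hS : Odd S.card) {ζ : Finset (Sym2 (Site 2))} (hζ : ζ ⊆ Eminus D v)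
    (corner : Fin nm → HexVertex) (hc : ∀ i, yc D i = corner i)
    (hpar : ∀ F ∈ triFacesTouching D.verts,
      (xiDeg ζ F % 2 = 1 ↔ F ∈ symmDiff ((Finset.univ : Finset (Fin nm)).image corner) (S.image (oppFace v)))) :
    IsCoreb D v S ζ := by
  classical
  have hcorners : corners D = (Finset.univ : Finset (Fin nm)).image corner := by
    unfold corners
    exact Finset.image_congr fun i _ => hc i
  refine ⟨hζ, hS, fun F hF => ?_⟩
  rw [Nat.odd_iff, hcorners]
  exact hpar F hF

end Universe

/-! ### Peeling: a core is determined by its free bonds -/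
section Peeling

/-- **the peeling check** on a schedule of (face, side-index) pairs, with `E ⊇ E⁻(v)` the bond universe and `known` the bonds determined so
far (initially the free bonds): at each step the face touches `G` and its two other sides are determined or outside `E`; at the end every bond
of `E` is determined. A `Bool`, evaluated by `decide`. [cite: KhristoforovSmirnov2021, §1.2 (arXiv v1 pp. 2–3: `W_Ω(U) = {ξ : ∂ξ = U}`)] -/
def schedOK (touching : Finset HexVertex) (E : Finset (Sym2 (Site 2))) : List (HexVertex × Fin 3) → Finset (Sym2 (Site 2)) → Bool
  | [], known => decide (E ⊆ known)
  | (F, j) :: rest, known =>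
    decide (F ∈ touching) && decide (∀ j' : Fin 3, j' ≠ j → side F j' ∈ known ∨ side F j' ∉ E) &&
      schedOK touching E rest (insert (side F j) known)

/-- the side count modulo two is a function of the three side memberships. [folklore] -/
private theorem xiDeg_eq_card (ζ : Finset (Sym2 (Site 2))) (F : HexVertex) :
    xiDeg ζ F = #((Finset.univ : Finset (Fin 3)).filter fun j => side F j ∈ ζ) := by
  unfold xiDeg side
  rfl

/-- parity bookkeeping on three Booleans: two side-indicator functions that agree off `j` and have side counts of the same parity agree
at `j` (the `2 × 8 × 8` cases). [folklore] -/
private theorem agree_third_bool : ∀ (j : Fin 3) (f g : Fin 3 → Bool), (∀ j', j' ≠ j → f j' = g j') →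
    (Odd #((Finset.univ : Finset (Fin 3)).filter fun j' => f j' = true) ↔
      Odd #((Finset.univ : Finset (Fin 3)).filter fun j' => g j' = true)) → f j = g j := by
  decide

/-- the same for decidable predicates. [folklore] -/
private theorem agree_third {p q : Fin 3 → Prop} [DecidablePred p] [DecidablePred q] (j : Fin 3) (hoff : ∀ j', j' ≠ j → (p j' ↔ q j'))
    (hpar : Odd #((Finset.univ : Finset (Fin 3)).filter p) ↔ Odd #((Finset.univ : Finset (Fin 3)).filter q)) : p j ↔ q j := by
  have hp : (Finset.univ : Finset (Fin 3)).filter p = (Finset.univ : Finset (Fin 3)).filter fun j' => decide (p j') = true :=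
    Finset.filter_congr fun j' _ => by rw [decide_eq_true_iff]
  have hq : (Finset.univ : Finset (Fin 3)).filter q = (Finset.univ : Finset (Fin 3)).filter fun j' => decide (q j') = true :=
    Finset.filter_congr fun j' _ => by rw [decide_eq_true_iff]
  rw [hp, hq] at hpar
  have e := agree_third_bool j (fun j' => decide (p j')) (fun j' => decide (q j'))
    (fun j' hj' => by rw [Bool.decide_congr (hoff j' hj')]) hpar
  simpa using e

/-- ★ **UNIQUENESS OF A CORE GIVEN ITS FREE PART**: if the peeling check passes, two cores at `v` with the same odd-neighbour set that agree
on the free bonds are equal. [cite: KhristoforovSmirnov2021, §1.2 (arXiv v1 pp. 2–3: `W_Ω(U) = {ξ : ∂ξ = U}`; p. 3: «exactly `2^{#Faces(Ω)}`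
loop configurations»); §2 Lemma 4, proof and Fig. 3 (p. 4)] -/
theorem core_eq_of_agree {v : HexVertex} {E Free : Finset (Sym2 (Site 2))} {sched : List (HexVertex × Fin 3)}
    (hE : Eminus D v ⊆ E) (hok : schedOK (triFacesTouching D.verts) E sched Free = true)
    {S : Finset (Fin 3)} {ζ ζ' : Finset (Sym2 (Site 2))} (hζ : IsCoreb D v S ζ) (hζ' : IsCoreb D v S ζ')
    (hagree : ∀ e ∈ Free, e ∈ ζ ↔ e ∈ ζ') : ζ = ζ' := by
  classical
  have hζE : ζ ⊆ E := fun b hb => hE (hζ.1 hb)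
  have hζ'E : ζ' ⊆ E := fun b hb => hE (hζ'.1 hb)
  -- the invariant along the schedule
  have main : ∀ (sc : List (HexVertex × Fin 3)) (known : Finset (Sym2 (Site 2))),
      schedOK (triFacesTouching D.verts) E sc known = true → (∀ e ∈ known, e ∈ ζ ↔ e ∈ ζ') → ∀ e ∈ E, e ∈ ζ ↔ e ∈ ζ' := by
    intro sc
    induction sc with
    | nil =>
      intro known hok hknown e he
      have hsub : E ⊆ known := by simpa [schedOK] using hok
      exact hknown e (hsub he)
    | cons Fj rest ih =>
      obtain ⟨F, j⟩ := Fj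
      intro known hok hknown
      simp only [schedOK, Bool.and_eq_true, decide_eq_true_eq] at hok
      obtain ⟨⟨hF, hother⟩, hrest⟩ := hok
      refine ih _ hrest fun e he => ?_
      rcases Finset.mem_insert.1 he with rfl | he
      · -- the parity at `F` pins the side `j`
        have hoff : ∀ j', j' ≠ j → (side F j' ∈ ζ ↔ side F j' ∈ ζ') := by
          intro j' hj'
          rcases hother j' hj' with h | h
          · exact hknown _ h
          · exact ⟨fun hm => absurd (hζE hm) h, fun hm => absurd (hζ'E hm) h⟩
        have hparζ := hζ.2.2 F hF
        have hparζ' := hζ'.2.2 F hF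
        have hpar : Odd (xiDeg ζ F) ↔ Odd (xiDeg ζ' F) := hparζ.trans hparζ'.symm
        rw [xiDeg_eq_card, xiDeg_eq_card] at hpar
        exact agree_third (p := fun j => side F j ∈ ζ) (q := fun j => side F j ∈ ζ') j hoff hpar
      · exact hknown e he
  have hall := main sched Free hok hagree
  ext e
  by_cases he : e ∈ E
  · exact hall e he
  · exact ⟨fun hm => absurd (hζE hm) he, fun hm => absurd (hζ'E hm) he⟩

/-- ★ **EVERY CORE IS IN THE TABLE**: if, moreover, a table `core : ι → _` of cores (same face, same odd-neighbour set) realises every subset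
of the free bonds, then every core equals a tabulated one. [cite: KhristoforovSmirnov2021, §1.2 (arXiv v1 p. 3: «exactly `2^{#Faces(Ω)}` loop
configurations»); §2 Lemma 4, proof and Fig. 3 (p. 4)] -/
theorem exists_eq_table {v : HexVertex} {E Free : Finset (Sym2 (Site 2))} {sched : List (HexVertex × Fin 3)}
    (hE : Eminus D v ⊆ E) (hok : schedOK (triFacesTouching D.verts) E sched Free = true)
    {S : Finset (Fin 3)} {ι : Type*} (core : ι → Finset (Sym2 (Site 2))) (hcore : ∀ i, IsCoreb D v S (core i))
    (hsurj : ∀ T ∈ Free.powerset, ∃ i, ∀ e ∈ Free, e ∈ core i ↔ e ∈ T)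
    {ζ : Finset (Sym2 (Site 2))} (hζ : IsCoreb D v S ζ) : ∃ i, ζ = core i := by
  classical
  obtain ⟨i, hi⟩ := hsurj (Free.filter (· ∈ ζ)) (Finset.mem_powerset.2 (Finset.filter_subset _ _))
  refine ⟨i, core_eq_of_agree hE hok hζ (hcore i) fun e he => ?_⟩
  rw [hi e he, Finset.mem_filter]
  exact ⟨fun h => ⟨he, h⟩, fun h => h.2⟩

end Peeling

/-! ### Pictures from a labelling of the faces -/
section Labelling

/-- an injective numerical code of a face (coordinates shifted into `ℕ`; faces of the small census domains have coordinates in `(-20, 30)`),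
used as the default label of a face lying in no listed class. [folklore] -/
def faceCode (F : HexVertex) : ℕ := 1000 + (F.1 0 + 20).toNat + 50 * (F.1 1 + 20).toNat + 2500 * F.2.val

/-- the label of a face read from a list of classes: the position (from `1`) of the first class containing it, else its code. [folklore] -/
def classLabel (cls : List (List HexVertex)) (F : HexVertex) : ℕ := go cls 1
where
  /-- Auxiliary. [folklore] -/
  go : List (List HexVertex) → ℕ → ℕ
  | [], _ => faceCode F
  | c :: rest, n => if F ∈ c then n else go rest (n + 1)

/-- a labelling of the faces constant across the bonds of `ζ` (checked on the faces touching `G`) is constant along links.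
[cite: KhristoforovSmirnov2021, §1.2 (arXiv v1 p. 2: the link pattern `IP(ξ)` — «a union of disjoint paths»)] -/
theorem lab_eq_of_xiLinked {ζ : Finset (Sym2 (Site 2))} (hζ : ζ ⊆ hBonds D) {L : Type*} (lab : HexVertex → L)
    (hclosed : ∀ F ∈ triFacesTouching D.verts, ∀ j : Fin 3, side F j ∈ ζ → lab (oppFace F j) = lab F)
    {Y Y' : HexVertex} (h : XiLinked ζ Y Y') : lab Y = lab Y' := by
  induction h with
  | refl => rfl
  | tail _ hst ih =>
    obtain ⟨j, rfl, hj⟩ := hst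
    have hside : side _ j ∈ ζ := hj
    rw [ih]
    exact (hclosed _ (mem_touching_of_side_mem D (hζ hside)) j hside).symm

/-- ★ **THE PICTURE FROM A LABELLING**: at a face `v` with three `H_G`-sides, a core `ζ` with all neighbours odd, a labelling `lab` of the faces
constant across the bonds of `ζ` that SEPARATES the three neighbours, a triple `p` of corners such that no corner other
than `y_{p i}` carries the label of the `i`-th neighbour, and a relation `L` = «the pairs of distinct non-partner corners with equal labels», which is a partial function:
then `ζ` is re-linking and its picture is `(p 0, p 1, p 2; L)` — and no other. No path is ever exhibited: the partners exist and the link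
relation is a perfect matching off the partners by the tree's structure theorems. (Corner faces through a table `corner = yc D`.)
[cite: KhristoforovSmirnov2021, §2 Lemma 4, proof and Fig. 3 (p. 4); §1.2 (arXiv v1 p. 2: «IP(ξ) is a union of disjoint paths, matching marked points»)] -/
theorem hasPicture_iff_of_labelling {v : HexVertex} (hv : AllSides D v) {ζ : Finset (Sym2 (Site 2))} (hq : IsCoreb D v Finset.univ ζ)
    (corner : Fin nm → HexVertex) (hc : ∀ i, yc D i = corner i) {L' : Type*} (lab : HexVertex → L')
    (hclosed : ∀ F ∈ triFacesTouching D.verts, ∀ j : Fin 3, side F j ∈ ζ → lab (oppFace F j) = lab F)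
    (p : Fin 3 → Fin nm)
    (hsep : ∀ i i' : Fin 3, i ≠ i' → lab (oppFace v i) ≠ lab (oppFace v i'))
    (huniq : ∀ (i : Fin 3) (c : Fin nm), lab (corner c) = lab (oppFace v i) → c = p i)
    (L : Finset (Fin nm × Fin nm)) (hL1 : ∀ cd ∈ L, ∀ i, cd.1 ≠ p i)
    (hL2 : ∀ c d : Fin nm, c ≠ d → (∀ i, c ≠ p i) → (∀ i, d ≠ p i) → lab (corner c) = lab (corner d) → (c, d) ∈ L)
    (hL3 : ∀ c d d' : Fin nm, (c, d) ∈ L → (c, d') ∈ L → d = d') :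
    ∀ P : PicIdx nm, HasPicture D v (Finset.univ, ζ) P ↔ P = (p 0, p 1, p 2, L) := by
  classical
  have hζh : ζ ⊆ hBonds D := core_subset_hBonds hq
  have hlink : ∀ {Y Y'}, XiLinked ζ Y Y' → lab Y = lab Y' := fun h => lab_eq_of_xiLinked hζh lab hclosed h
  -- the neighbours are pairwise unlinked
  have hnl : ∀ i i' : Fin 3, i ≠ i' → ¬ XiLinked ζ (oppFace v i) (oppFace v i') :=
    fun i i' hii' h => hsep i i' hii' (hlink h)
  -- the partners are `p`
  have hp : ∀ i : Fin 3, XiLinked ζ (oppFace v i) (yc D (p i)) := by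
    intro i
    obtain ⟨c, hcl⟩ := hbK_core_partners hv hq hnl i
    have e : c = p i := huniq i c (by rw [← hc]; exact (hlink hcl).symm)
    rw [← e]; exact hcl
  -- the link relation is `L`
  have hT := tripodPicture_of_core hv hq hnl hp
  have hsub : linkRel D ζ ⊆ L := by
    rintro ⟨c, d⟩ hcd
    obtain ⟨hne, hl⟩ := mem_linkRel.1 hcd
    obtain ⟨c0, c1, c2⟩ := hT.off c d hcd
    obtain ⟨d0, d1, d2⟩ := hT.off d c (hT.symm c d hcd)
    have h3 : ∀ i : Fin 3, i = 0 ∨ i = 1 ∨ i = 2 := by decide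
    refine hL2 c d hne (fun i => ?_) (fun i => ?_) ?_
    · rcases h3 i with rfl | rfl | rfl
      · exact c0
      · exact c1
      · exact c2
    · rcases h3 i with rfl | rfl | rfl
      · exact d0
      · exact d1
      · exact d2
    · have := hlink hl
      rwa [hc, hc] at this
  have hrel : linkRel D ζ = L := by
    refine Finset.Subset.antisymm hsub ?_
    rintro ⟨c, d⟩ hcd
    obtain ⟨d', hd', -⟩ := hT.perfect c (hL1 _ hcd 0) (hL1 _ hcd 1) (hL1 _ hcd 2)
    have e : d' = d := hL3 c d' d (hsub hd') hcd
    rw [← e]; exact hd'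
  intro P
  rw [hasPicture_iff_eq hv hq hnl hp P, hrel]

end Labelling

/-! ### Counting from a complete table -/
section Counting

/-- decidable equality of picture indices as a NAMED instance (the structural instance term exceeds the synthesis size bound inside
`DecidablePred`). [folklore] -/
instance decEqPicIdx : DecidableEq (PicIdx nm) := inferInstance

/-- ★ **THE PICTURE COUNTS FROM A CENSUS**: with an injective table `core : ι → _` of ALL the cores at `v` having the three neighbours odd, and
their pictures `pic` (`none` for a core that is not re-linking), `c_P(v) = #{i | pic i = P}`.
[cite: KhristoforovSmirnov2021, §2 Lemma 4, proof and Fig. 3 (p. 4: the triples at a vertex and their link patterns)] -/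
theorem pictureCount_eq_card_filter {v : HexVertex} {ι : Type*} [Fintype ι] [DecidableEq ι] (core : ι → Finset (Sym2 (Site 2)))
    (hinj : Function.Injective core) (hcore : ∀ i, IsCoreb D v Finset.univ (core i))
    (hcomplete : ∀ ζ, IsCoreb D v Finset.univ ζ → ∃ i, ζ = core i) (pic : ι → Option (PicIdx nm))
    (hpic : ∀ i P, HasPicture D v (Finset.univ, core i) P ↔ pic i = some P) (P : PicIdx nm) :
    pictureCount D v P = #((Finset.univ : Finset ι).filter fun i => pic i = some P) := by
  classical
  unfold pictureCount
  symm
  refine Finset.card_bij (fun i _ => (Finset.univ, core i)) (fun i hi => ?_) (fun i hi i' hi' h => ?_) (fun q hq => ?_)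
  · rw [Finset.mem_filter] at hi ⊢
    refine ⟨?_, (hpic i P).2 hi.2⟩
    unfold coreSetb
    rw [Finset.mem_filter]
    exact ⟨Finset.mem_product.2 ⟨Finset.mem_univ _, Finset.mem_powerset.2 (hcore i).1⟩, hcore i⟩
  · exact hinj (congrArg Prod.snd h)
  · rw [Finset.mem_filter] at hq
    obtain ⟨hmem, hP⟩ := hq
    have hcoreq : IsCoreb D v q.1 q.2 := by
      unfold coreSetb at hmem
      exact (Finset.mem_filter.1 hmem).2
    obtain ⟨S, ζ⟩ := q
    have hS : S = Finset.univ := hP.1.1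
    subst hS
    obtain ⟨i, rfl⟩ := hcomplete ζ hcoreq
    exact ⟨i, Finset.mem_filter.2 ⟨Finset.mem_univ _, (hpic i P).1 hP⟩, rfl⟩

/-- the sum over all picture indices of a count-weighted function is the sum over the realised pictures.
[cite: KhristoforovSmirnov2021, §2 Lemma 4 eq. (3) (p. 4)] -/
theorem sum_pictureCount_eq_sum_table {v : HexVertex} {ι : Type*} [Fintype ι] [DecidableEq ι] (core : ι → Finset (Sym2 (Site 2)))
    (hinj : Function.Injective core) (hcore : ∀ i, IsCoreb D v Finset.univ (core i))
    (hcomplete : ∀ ζ, IsCoreb D v Finset.univ ζ → ∃ i, ζ = core i) (pic : ι → Option (PicIdx nm))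
    (hpic : ∀ i P, HasPicture D v (Finset.univ, core i) P ↔ pic i = some P) (f : PicIdx nm → ℂ) :
    ∑ P : PicIdx nm, (pictureCount D v P : ℂ) * f P = ∑ i : ι, ((pic i).map f).getD 0 := by
  have hcount : ∀ P, pictureCount D v P = #((Finset.univ : Finset ι).filter fun i => pic i = some P) :=
    pictureCount_eq_card_filter core hinj hcore hcomplete pic hpic
  -- regroup the sum over `ι` by the value of `pic`
  have rhs : ∀ i : ι, ((pic i).map f).getD 0 = ∑ P : PicIdx nm, if pic i = some P then f P else 0 := by
    intro i
    cases h : pic i with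
    | none => simp
    | some P₀ =>
      simp only [Option.map_some, Option.getD_some, Option.some.injEq]
      rw [Finset.sum_ite_eq]
      simp
  rw [Finset.sum_congr rfl fun i _ => rhs i, Finset.sum_comm]
  refine Finset.sum_congr rfl fun P _ => ?_
  rw [hcount P, ← nsmul_eq_mul, ← Finset.sum_const, Finset.sum_filter]

/-- regrouping the table sum by the value of the picture: `Σ_i g(pic i) = Σ_{o ∈ image} #fibre(o) • g o` (so that a census with few
distinct pictures is summed by a handful of fibre cardinalities). [cite: KhristoforovSmirnov2021, §2 Lemma 4 eq. (3) (p. 4)] -/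
theorem sum_table_eq_sum_image {ι : Type*} [Fintype ι] [DecidableEq ι] (pic : ι → Option (PicIdx nm)) (f : PicIdx nm → ℂ) :
    ∑ i : ι, ((pic i).map f).getD 0 =
      ∑ o ∈ (Finset.univ : Finset ι).image pic, (#((Finset.univ : Finset ι).filter fun i => pic i = o) : ℂ) * (o.map f).getD 0 := by
  have h := Finset.sum_comp (s := (Finset.univ : Finset ι)) (fun o : Option (PicIdx nm) => (o.map f).getD 0) pic
  rw [h]
  refine Finset.sum_congr rfl fun o _ => ?_
  rw [nsmul_eq_mul]

end Counting

end Literature.Probability.Percolation.MarkedLoops
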